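import Summits.AtomisticToContinuum.FouriersLaw.Theorems.BondHeatUncertaintySubdiffusiveBondHeatCovariantStaticsTools

/-!
# `SubdiffusiveBondHeat` · the SCALING-COVARIANT statics `∃ b, ∀ T > 0, ∀ N ≥ 2, E_{μ_T^N}[e₀²] ≤ b·T²` (decomp-a2c hand-2 g19, critic row 691 (b))

The one new static lemma sized by lens-1 g55 (EXCERPT §4) for the covariant rung of the `KineticCorrectorBudget` ladder:
`siteEnergy_sq_le_covariant : ∀ ω₂ lam β γ > 0, ∃ b, ∀ T > 0, ∀ N > 1, ∫ e₀² dμ_T^N ≤ b·T²` with `e₀ = p₀²/2 + U(q₀) + ½V(q₁ − q₀)` spelled as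
in `localEnergyMoment`.  Proof: pointwise `e₀² ≤ p₀⁴/2 + (2ω₂² + 4)q₀⁴ + 4q₁⁴ + (lam²/2 + 16β²)q₀⁸ + 16β²q₁⁸` (no constant term);
`∫ p₀⁴ = ≤ 3T²` (tree `stub_gibbsMomentumFourthMoment`); for the positions the chain-to-one-site Chebyshev step (`lintegral_coord_zero/one_mul_le`)
followed by a SECOND Chebyshev reweighting at one site (`…CovariantStaticsTools`): dropping `e^{−lam a⁴/(4T)}` bounds `E[q_i⁴]` by the fourth moment of
the Gaussian weight `e^{−(ω₂/2T)a²}` `= (2T/ω₂)²·R₄`, dropping `e^{−ω₂a²/(2T)}` bounds `E[q_i⁸]` by the eighth moment of the quartic weight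
`e^{−(lam/4T)a⁴}` `= (4T/lam)²·R₈` (scaling; `R₄, R₈` the absolute moments at unit coefficient — finite positive constants, never evaluated).
[folklore]; 0 sorry; no definitions.  `--supports stmt-AtomisticToContinuum-9120`.
-/

noncomputable section

open MeasureTheory Set Filter
open scoped ENNReal

namespace Summit.AtomisticToContinuum.FouriersLaw.Theorems.SubdiffusiveBondHeat

open Literature.MathematicalPhysics.KineticTheory.HeatConduction

/-! ## §1. The pointwise bound without constant term -/

/-- `e₀² ≤ p⁴/2 + (2ω₂² + 4)a⁴ + 4b⁴ + (lam²/2 + 16β²)a⁸ + 16β²b⁸` (`a = q₀`, `b = q₁`, `p = p₀`). [folklore] -/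
theorem siteEnergy_sq_le_pointwise (ω₂ lam β γ p a b : ℝ) :
    (p ^ 2 / 2 + (pinnedChain ω₂ lam β γ).U a + (pinnedChain ω₂ lam β γ).V (b - a) / 2) ^ 2 ≤
      p ^ 4 / 2 + (2 * ω₂ ^ 2 + 4) * a ^ 4 + 4 * b ^ 4 + (lam ^ 2 / 2 + 16 * β ^ 2) * a ^ 8 + 16 * β ^ 2 * b ^ 8 := by
  have hU : (pinnedChain ω₂ lam β γ).U a = ω₂ * a ^ 2 / 2 + lam * a ^ 4 / 4 := rfl
  have hV : (pinnedChain ω₂ lam β γ).V (b - a) = (b - a) ^ 2 / 2 + β * (b - a) ^ 4 / 4 := rfl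
  rw [hU, hV]
  have hr4 := sub_pow_four_le a b
  have hr8 := sub_pow_eight_le a b
  have hβ2 : 0 ≤ β ^ 2 := sq_nonneg β
  -- the four squares
  have t1 : (ω₂ * a ^ 2 / 2) ^ 2 = ω₂ ^ 2 * a ^ 4 / 4 := by ring
  have t2 : (lam * a ^ 4 / 4) ^ 2 = lam ^ 2 * a ^ 8 / 16 := by ring
  have t3 : ((b - a) ^ 2 / 4) ^ 2 ≤ (a ^ 4 + b ^ 4) / 2 := by
    have e : ((b - a) ^ 2 / 4) ^ 2 = (b - a) ^ 4 / 16 := by ring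
    rw [e]; linarith
  have t4 : (β * (b - a) ^ 4 / 8) ^ 2 ≤ 2 * β ^ 2 * (a ^ 8 + b ^ 8) := by
    have e : (β * (b - a) ^ 4 / 8) ^ 2 = β ^ 2 * ((b - a) ^ 8 / 64) := by ring
    rw [e]
    have : (b - a) ^ 8 / 64 ≤ 2 * (a ^ 8 + b ^ 8) := by linarith
    nlinarith [mul_le_mul_of_nonneg_left this hβ2]
  have step := sq_add_four_le (ω₂ * a ^ 2 / 2) (lam * a ^ 4 / 4) ((b - a) ^ 2 / 4) (β * (b - a) ^ 4 / 8)
  set W := ω₂ * a ^ 2 / 2 + lam * a ^ 4 / 4 + (b - a) ^ 2 / 4 + β * (b - a) ^ 4 / 8 with hW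
  have hW2 : W ^ 2 ≤ ω₂ ^ 2 * a ^ 4 + lam ^ 2 * a ^ 8 / 4 + 2 * (a ^ 4 + b ^ 4) + 8 * β ^ 2 * (a ^ 8 + b ^ 8) := by
    rw [t1, t2] at step
    linarith
  have hrw : p ^ 2 / 2 + (ω₂ * a ^ 2 / 2 + lam * a ^ 4 / 4) + ((b - a) ^ 2 / 2 + β * (b - a) ^ 4 / 4) / 2 = p ^ 2 / 2 + W := by
    rw [hW]; ring
  rw [hrw]
  have h1 : (p ^ 2 / 2 + W) ^ 2 ≤ 2 * (p ^ 2 / 2) ^ 2 + 2 * W ^ 2 := by nlinarith [sq_nonneg (p ^ 2 / 2 - W)]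
  have e2 : 2 * (p ^ 2 / 2) ^ 2 = p ^ 4 / 2 := by ring
  have hfin : p ^ 4 / 2 + 2 * (ω₂ ^ 2 * a ^ 4 + lam ^ 2 * a ^ 8 / 4 + 2 * (a ^ 4 + b ^ 4) + 8 * β ^ 2 * (a ^ 8 + b ^ 8)) =
      p ^ 4 / 2 + (2 * ω₂ ^ 2 + 4) * a ^ 4 + 4 * b ^ 4 + (lam ^ 2 / 2 + 16 * β ^ 2) * a ^ 8 + 16 * β ^ 2 * b ^ 8 := by ring
  linarith

/-! ## §2. Chain + one-site Chebyshev: the `hq` hypothesis for a factorised one-site weight -/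

/-- **Two Chebyshev steps combined.**  `X·IU ≤ HU·Z` (chain → one site) and `HU·IW ≤ HW·IU` (one-site reweighting), with `0 < IU < ∞`, give
`X·IW ≤ HW·Z`. [folklore] -/
theorem ennreal_chain_two {X IU HU Z IW HW : ℝ≥0∞} (h1 : X * IU ≤ HU * Z) (h2 : HU * IW ≤ HW * IU) (hIU0 : IU ≠ 0)
    (hIU : IU ≠ ⊤) : X * IW ≤ HW * Z := by
  have h3 : X * IW * IU ≤ HW * Z * IU :=
    calc X * IW * IU = X * IU * IW := by ring
      _ ≤ HU * Z * IW := by gcongr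
      _ = HU * IW * Z := by ring
      _ ≤ HW * IU * Z := by gcongr
      _ = HW * Z * IU := by ring
  calc X * IW = X * IW * (IU * IU⁻¹) := by rw [ENNReal.mul_inv_cancel hIU0 hIU, mul_one]
    _ = X * IW * IU * IU⁻¹ := by ring
    _ ≤ HW * Z * IU * IU⁻¹ := by gcongr
    _ = HW * Z * (IU * IU⁻¹) := by ring
    _ = HW * Z := by rw [ENNReal.mul_inv_cancel hIU0 hIU, mul_one]

/-- `a ↦ a⁴` (in `ℝ≥0∞`) is radially non-decreasing. [folklore] -/
theorem radMono_ofReal_pow_four :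
    ∀ ⦃a b : ℝ⦄, |a| ≤ |b| → ENNReal.ofReal (a ^ 4) ≤ ENNReal.ofReal (b ^ 4) := by
  intro a b h
  refine ENNReal.ofReal_le_ofReal ?_
  have := pow_le_pow_left₀ (abs_nonneg a) h 4
  rwa [Even.pow_abs ⟨2, rfl⟩, Even.pow_abs ⟨2, rfl⟩] at this

/-- `a ↦ e^{−κ a⁴}` and `a ↦ e^{−κ a²}` (`κ ≥ 0`) are radially non-increasing. [folklore] -/
theorem radAnti_exp_neg_pow {κ : ℝ} (hκ : 0 ≤ κ) (k : ℕ) (hk : Even k) :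
    ∀ ⦃a b : ℝ⦄, |a| ≤ |b| → ENNReal.ofReal (Real.exp (-κ * b ^ k)) ≤ ENNReal.ofReal (Real.exp (-κ * a ^ k)) := by
  intro a b h
  refine ENNReal.ofReal_le_ofReal (Real.exp_le_exp.mpr ?_)
  have := pow_le_pow_left₀ (abs_nonneg a) h k
  rw [hk.pow_abs, hk.pow_abs] at this
  nlinarith

/-! ## §3. The covariant position moments -/

section Moments

variable {ω₂ lam β γ T : ℝ} (hω : 0 < ω₂) (hl : 0 < lam) (hβ : 0 < β) (hT : 0 < T)
include hω hl hβ hT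

omit hω hl hβ in
/-- The one-site weight factorises: `e^{−U(a)/T} = e^{−(lam/4T)a⁴} · e^{−(ω₂/2T)a²}` (as `ℝ≥0∞` products, both orders available by `mul_comm`).
[folklore] -/
theorem exp_neg_U_div_eq (a : ℝ) :
    ENNReal.ofReal (Real.exp (-(pinnedChain ω₂ lam β γ).U a / T)) =
      ENNReal.ofReal (Real.exp (-(lam / (4 * T)) * a ^ 4)) * ENNReal.ofReal (Real.exp (-(ω₂ / (2 * T)) * a ^ 2)) := by
  rw [← ENNReal.ofReal_mul (Real.exp_pos _).le, ← Real.exp_add]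
  congr 2
  show -(ω₂ * a ^ 2 / 2 + lam * a ^ 4 / 4) / T = _
  field_simp
  ring

/-- ★ **Covariant fourth moments**: `∫ q_i⁴ dμ_T^N ≤ (2T/ω₂)²·R₄` for `i = 0, 1`, every `N ≥ 2`, with
`R₄ = (∫ t⁴e^{−t²})/(∫ e^{−t²})` (and integrability). [folklore] -/
theorem moment_four_le {N : ℕ} (hN : 1 < N) (i : Fin N) (hi : i.val = 0 ∨ i.val = 1) :
    Integrable (fun z : PhaseSpace N => (z.1 i) ^ 4) ((pinnedChain ω₂ lam β γ).gibbsMeasure N T) ∧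
      ∫ z, (z.1 i) ^ 4 ∂((pinnedChain ω₂ lam β γ).gibbsMeasure N T) ≤
        (2 * T / ω₂) ^ 2 * ((∫⁻ t, ENNReal.ofReal (t ^ 4 * Real.exp (-1 * t ^ 2))).toReal /
          (∫⁻ t, ENNReal.ofReal (Real.exp (-1 * t ^ 2))).toReal) := by
  set P := pinnedChain ω₂ lam β γ with hP
  set c : ℝ := ω₂ / (2 * T) with hc
  have hc0 : 0 < c := by positivity
  obtain ⟨hIW0, hIW, hHW⟩ := gauss_weight_facts hc0
  have hUc : Continuous P.U := (pinnedChain_contDiff_U ω₂ lam β γ (n := 0)).continuous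
  have hVc : Continuous P.V := (pinnedChain_contDiff_V ω₂ lam β γ (n := 0)).continuous
  have hU := pinnedChain_U_radMono (β := β) hω.le hl.le γ
  have hV := pinnedChain_V_radMono hβ.le ω₂ lam γ
  have hIU := pinnedChain_lintegral_exp_neg_U_ne_top (β := β) hω hl.le γ hT
  have hIU0 := pinnedChain_lintegral_exp_neg_U_ne_zero ω₂ lam β γ T
  have h4m : Measurable fun a : ℝ => ENNReal.ofReal (a ^ 4) := by fun_prop
  -- chain step
  obtain ⟨n, rfl⟩ : ∃ n, N = n + 2 := ⟨N - 2, by omega⟩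
  have hchain : (∫⁻ q : Fin (n + 2) → ℝ, ENNReal.ofReal ((q i) ^ 4) * ENNReal.ofReal (Real.exp (-P.potential (n + 2) q / T))) *
      ∫⁻ a, ENNReal.ofReal (Real.exp (-P.U a / T)) ≤
      (∫⁻ a, ENNReal.ofReal (a ^ 4) * ENNReal.ofReal (Real.exp (-P.U a / T))) *
        ∫⁻ q : Fin (n + 2) → ℝ, ENNReal.ofReal (Real.exp (-P.potential (n + 2) q / T)) := by
    rcases hi with h0 | h1
    · have : i = 0 := Fin.ext h0
      subst this
      exact lintegral_coord_zero_mul_le hUc hVc hU hV hT.le (n + 1) h4m radMono_ofReal_pow_four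
    · have : i = 1 := Fin.ext (by rw [Fin.val_one]; exact h1)
      subst this
      exact lintegral_coord_one_mul_le hUc hVc hU hV hT.le n h4m radMono_ofReal_pow_four
  -- one-site Chebyshev: drop the quartic factor
  have hcheb := chebyshev_lintegral (w := fun a => ENNReal.ofReal (Real.exp (-c * a ^ 2)))
    (h := fun a => ENNReal.ofReal (a ^ 4)) (g := fun a => ENNReal.ofReal (Real.exp (-(lam / (4 * T)) * a ^ 4)))
    (by fun_prop) h4m (by fun_prop) radMono_ofReal_pow_four (radAnti_exp_neg_pow (by positivity) 4 ⟨2, rfl⟩)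
  have hfac : ∀ a, ENNReal.ofReal (Real.exp (-P.U a / T)) =
      ENNReal.ofReal (Real.exp (-(lam / (4 * T)) * a ^ 4)) * ENNReal.ofReal (Real.exp (-c * a ^ 2)) :=
    fun a => exp_neg_U_div_eq hT a
  have hHU : (∫⁻ a, ENNReal.ofReal (a ^ 4) * ENNReal.ofReal (Real.exp (-P.U a / T))) =
      ∫⁻ a, ENNReal.ofReal (a ^ 4) * ENNReal.ofReal (Real.exp (-(lam / (4 * T)) * a ^ 4)) * ENNReal.ofReal (Real.exp (-c * a ^ 2)) :=
    lintegral_congr fun a => by rw [hfac, mul_assoc]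
  have hIUeq : (∫⁻ a, ENNReal.ofReal (Real.exp (-P.U a / T))) =
      ∫⁻ a, ENNReal.ofReal (Real.exp (-(lam / (4 * T)) * a ^ 4)) * ENNReal.ofReal (Real.exp (-c * a ^ 2)) :=
    lintegral_congr fun a => hfac a
  have hHWeq : (∫⁻ a, ENNReal.ofReal (a ^ 4) * ENNReal.ofReal (Real.exp (-c * a ^ 2))) =
      ∫⁻ a, ENNReal.ofReal (a ^ 4 * Real.exp (-c * a ^ 2)) :=
    lintegral_congr fun a => by rw [ENNReal.ofReal_mul (by positivity)]
  rw [← hHU, ← hIUeq, hHWeq] at hcheb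
  have hq := ennreal_chain_two hchain hcheb hIU0 hIU
  have hres := pinnedChain_integrable_and_fn_moment_le hω hl.le hβ.le γ hT i (h := fun x => x ^ 4) (by fun_prop)
    (fun x => by positivity) hHW hIW0 hIW hq
  refine ⟨hres.1, hres.2.trans (le_of_eq ?_)⟩
  -- scaling
  obtain ⟨s4, s0⟩ := gauss_scaling hc0
  rw [s4, s0, ENNReal.toReal_mul, ENNReal.toReal_mul, ENNReal.toReal_ofReal (by positivity),
    ENNReal.toReal_ofReal (by positivity)]
  have hsc : 0 < Real.sqrt c := Real.sqrt_pos.mpr hc0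
  have hs2 : (Real.sqrt c) ^ 2 = c := Real.sq_sqrt hc0.le
  have hκ4 : ((Real.sqrt c)⁻¹) ^ 4 = (2 * T / ω₂) ^ 2 := by
    rw [inv_pow, show (4:ℕ) = 2 * 2 by norm_num, pow_mul, hs2, hc]
    field_simp
  rw [mul_div_mul_comm, show ((Real.sqrt c)⁻¹) ^ 5 / (Real.sqrt c)⁻¹ = ((Real.sqrt c)⁻¹) ^ 4 by
    field_simp, hκ4]

/-- ★ **Covariant eighth moments**: `∫ q_i⁸ dμ_T^N ≤ (4T/lam)²·R₈` for `i = 0, 1`, every `N ≥ 2`, with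
`R₈ = (∫ t⁸e^{−t⁴})/(∫ e^{−t⁴})` (and integrability). [folklore] -/
theorem moment_eight_le {N : ℕ} (hN : 1 < N) (i : Fin N) (hi : i.val = 0 ∨ i.val = 1) :
    Integrable (fun z : PhaseSpace N => (z.1 i) ^ 8) ((pinnedChain ω₂ lam β γ).gibbsMeasure N T) ∧
      ∫ z, (z.1 i) ^ 8 ∂((pinnedChain ω₂ lam β γ).gibbsMeasure N T) ≤
        (4 * T / lam) ^ 2 * ((∫⁻ t, ENNReal.ofReal (t ^ 8 * Real.exp (-1 * t ^ 4))).toReal /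
          (∫⁻ t, ENNReal.ofReal (Real.exp (-1 * t ^ 4))).toReal) := by
  set P := pinnedChain ω₂ lam β γ with hP
  set c : ℝ := lam / (4 * T) with hc
  have hc0 : 0 < c := by positivity
  obtain ⟨hIW0, hIW, hHW⟩ := quartic_weight_facts hc0
  have hUc : Continuous P.U := (pinnedChain_contDiff_U ω₂ lam β γ (n := 0)).continuous
  have hVc : Continuous P.V := (pinnedChain_contDiff_V ω₂ lam β γ (n := 0)).continuous
  have hU := pinnedChain_U_radMono (β := β) hω.le hl.le γ
  have hV := pinnedChain_V_radMono hβ.le ω₂ lam γ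
  have hIU := pinnedChain_lintegral_exp_neg_U_ne_top (β := β) hω hl.le γ hT
  have hIU0 := pinnedChain_lintegral_exp_neg_U_ne_zero ω₂ lam β γ T
  have h8m : Measurable fun a : ℝ => ENNReal.ofReal (a ^ 8) := by fun_prop
  obtain ⟨n, rfl⟩ : ∃ n, N = n + 2 := ⟨N - 2, by omega⟩
  have hchain : (∫⁻ q : Fin (n + 2) → ℝ, ENNReal.ofReal ((q i) ^ 8) * ENNReal.ofReal (Real.exp (-P.potential (n + 2) q / T))) *
      ∫⁻ a, ENNReal.ofReal (Real.exp (-P.U a / T)) ≤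
      (∫⁻ a, ENNReal.ofReal (a ^ 8) * ENNReal.ofReal (Real.exp (-P.U a / T))) *
        ∫⁻ q : Fin (n + 2) → ℝ, ENNReal.ofReal (Real.exp (-P.potential (n + 2) q / T)) := by
    rcases hi with h0 | h1
    · have : i = 0 := Fin.ext h0
      subst this
      exact lintegral_coord_zero_mul_le hUc hVc hU hV hT.le (n + 1) h8m radMono_ofReal_pow_eight
    · have : i = 1 := Fin.ext (by rw [Fin.val_one]; exact h1)
      subst this
      exact lintegral_coord_one_mul_le hUc hVc hU hV hT.le n h8m radMono_ofReal_pow_eight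
  -- one-site Chebyshev: drop the Gaussian factor
  have hcheb := chebyshev_lintegral (w := fun a => ENNReal.ofReal (Real.exp (-c * a ^ 4)))
    (h := fun a => ENNReal.ofReal (a ^ 8)) (g := fun a => ENNReal.ofReal (Real.exp (-(ω₂ / (2 * T)) * a ^ 2)))
    (by fun_prop) h8m (by fun_prop) radMono_ofReal_pow_eight (radAnti_exp_neg_pow (by positivity) 2 ⟨1, rfl⟩)
  have hfac : ∀ a, ENNReal.ofReal (Real.exp (-P.U a / T)) =
      ENNReal.ofReal (Real.exp (-(ω₂ / (2 * T)) * a ^ 2)) * ENNReal.ofReal (Real.exp (-c * a ^ 4)) :=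
    fun a => by rw [exp_neg_U_div_eq hT a, mul_comm]
  have hHU : (∫⁻ a, ENNReal.ofReal (a ^ 8) * ENNReal.ofReal (Real.exp (-P.U a / T))) =
      ∫⁻ a, ENNReal.ofReal (a ^ 8) * ENNReal.ofReal (Real.exp (-(ω₂ / (2 * T)) * a ^ 2)) * ENNReal.ofReal (Real.exp (-c * a ^ 4)) :=
    lintegral_congr fun a => by rw [hfac, mul_assoc]
  have hIUeq : (∫⁻ a, ENNReal.ofReal (Real.exp (-P.U a / T))) =
      ∫⁻ a, ENNReal.ofReal (Real.exp (-(ω₂ / (2 * T)) * a ^ 2)) * ENNReal.ofReal (Real.exp (-c * a ^ 4)) :=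
    lintegral_congr fun a => hfac a
  have hHWeq : (∫⁻ a, ENNReal.ofReal (a ^ 8) * ENNReal.ofReal (Real.exp (-c * a ^ 4))) =
      ∫⁻ a, ENNReal.ofReal (a ^ 8 * Real.exp (-c * a ^ 4)) :=
    lintegral_congr fun a => by rw [ENNReal.ofReal_mul (by positivity)]
  rw [← hHU, ← hIUeq, hHWeq] at hcheb
  have hq := ennreal_chain_two hchain hcheb hIU0 hIU
  have hres := pinnedChain_integrable_and_fn_moment_le hω hl.le hβ.le γ hT i (h := fun x => x ^ 8) (by fun_prop)
    (fun x => by positivity) hHW hIW0 hIW hq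
  refine ⟨hres.1, hres.2.trans (le_of_eq ?_)⟩
  obtain ⟨s8, s0⟩ := quartic_scaling hc0
  rw [s8, s0, ENNReal.toReal_mul, ENNReal.toReal_mul, ENNReal.toReal_ofReal (by positivity),
    ENNReal.toReal_ofReal (by positivity)]
  have hsc : 0 < Real.sqrt c := Real.sqrt_pos.mpr hc0
  have hssc : 0 < Real.sqrt (Real.sqrt c) := Real.sqrt_pos.mpr hsc
  have hs4 : (Real.sqrt (Real.sqrt c)) ^ 4 = c := by
    rw [show (4:ℕ) = 2 * 2 by norm_num, pow_mul, Real.sq_sqrt hsc.le, Real.sq_sqrt hc0.le]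
  have hκ8 : ((Real.sqrt (Real.sqrt c))⁻¹) ^ 8 = (4 * T / lam) ^ 2 := by
    rw [inv_pow, show (8:ℕ) = 4 * 2 by norm_num, pow_mul, hs4, hc]
    field_simp
  rw [mul_div_mul_comm, show ((Real.sqrt (Real.sqrt c))⁻¹) ^ 9 / (Real.sqrt (Real.sqrt c))⁻¹ =
    ((Real.sqrt (Real.sqrt c))⁻¹) ^ 8 by field_simp, hκ8]

end Moments

/-! ## §4. The covariant statics -/

/-- ★★ **THE SCALING-COVARIANT STATICS**: for all parameters `ω₂, lam, β, γ > 0` there is `b = b(ω₂, lam, β)` with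
`E_{μ_T^N}[e₀²] ≤ b·T²` for EVERY `T > 0` and EVERY `N ≥ 2` (`e₀ = p₀²/2 + U(q₀) + ½V(q₁ − q₀)` as in `localEnergyMoment`). [folklore] -/
theorem siteEnergy_sq_le_covariant :
    ∀ ω₂ lam β γ : ℝ, 0 < ω₂ → 0 < lam → 0 < β → 0 < γ → ∃ b : ℝ, ∀ T : ℝ, 0 < T → ∀ (N : ℕ) (hN : 1 < N),
      ∫ z, ((z.2 ⟨0, Nat.zero_lt_of_lt hN⟩) ^ 2 / 2 + (pinnedChain ω₂ lam β γ).U (z.1 ⟨0, Nat.zero_lt_of_lt hN⟩) +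
        (pinnedChain ω₂ lam β γ).V (z.1 ⟨1, hN⟩ - z.1 ⟨0, Nat.zero_lt_of_lt hN⟩) / 2) ^ 2
        ∂((pinnedChain ω₂ lam β γ).gibbsMeasure N T) ≤ b * T ^ 2 := by
  intro ω₂ lam β γ hω hl hβ hγ
  set R₄ : ℝ := (∫⁻ t, ENNReal.ofReal (t ^ 4 * Real.exp (-1 * t ^ 2))).toReal /
    (∫⁻ t, ENNReal.ofReal (Real.exp (-1 * t ^ 2))).toReal with hR₄
  set R₈ : ℝ := (∫⁻ t, ENNReal.ofReal (t ^ 8 * Real.exp (-1 * t ^ 4))).toReal /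
    (∫⁻ t, ENNReal.ofReal (Real.exp (-1 * t ^ 4))).toReal with hR₈
  have hR₄0 : 0 ≤ R₄ := div_nonneg ENNReal.toReal_nonneg ENNReal.toReal_nonneg
  have hR₈0 : 0 ≤ R₈ := div_nonneg ENNReal.toReal_nonneg ENNReal.toReal_nonneg
  refine ⟨3 / 2 + (2 * ω₂ ^ 2 + 8) * ((2 / ω₂) ^ 2 * R₄) + (lam ^ 2 / 2 + 32 * β ^ 2) * ((4 / lam) ^ 2 * R₈), fun T hT N hN => ?_⟩
  set μ := (pinnedChain ω₂ lam β γ).gibbsMeasure N T with hμ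
  haveI : IsProbabilityMeasure μ := pinnedChain_isProbabilityMeasure_gibbsMeasure hω hl.le hβ.le γ N hT
  have h0N : 0 < N := Nat.zero_lt_of_lt hN
  obtain ⟨hp4, hp4le⟩ := stub_gibbsMomentumFourthMoment ω₂ lam β γ hω hl hβ hγ T hT N h0N
  obtain ⟨ha4, ha4le⟩ := moment_four_le hω hl hβ hT hN (⟨0, h0N⟩ : Fin N) (Or.inl rfl)
  obtain ⟨hb4, hb4le⟩ := moment_four_le hω hl hβ hT hN (⟨1, hN⟩ : Fin N) (Or.inr rfl)
  obtain ⟨ha8, ha8le⟩ := moment_eight_le hω hl hβ hT hN (⟨0, h0N⟩ : Fin N) (Or.inl rfl)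
  obtain ⟨hb8, hb8le⟩ := moment_eight_le hω hl hβ hT hN (⟨1, hN⟩ : Fin N) (Or.inr rfl)
  set A₄ : ℝ := 2 * ω₂ ^ 2 + 4 with hA₄
  set A₈ : ℝ := lam ^ 2 / 2 + 16 * β ^ 2 with hA₈
  set g : PhaseSpace N → ℝ := fun z => (z.2 ⟨0, h0N⟩) ^ 4 / 2 + A₄ * (z.1 ⟨0, h0N⟩) ^ 4 + 4 * (z.1 ⟨1, hN⟩) ^ 4 +
    A₈ * (z.1 ⟨0, h0N⟩) ^ 8 + 16 * β ^ 2 * (z.1 ⟨1, hN⟩) ^ 8 with hg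
  have i1 : Integrable (fun z : PhaseSpace N => (z.2 ⟨0, h0N⟩) ^ 4 / 2) μ := hp4.div_const 2
  have i2 : Integrable (fun z : PhaseSpace N => A₄ * (z.1 ⟨0, h0N⟩) ^ 4) μ := ha4.const_mul A₄
  have i3 : Integrable (fun z : PhaseSpace N => 4 * (z.1 ⟨1, hN⟩) ^ 4) μ := hb4.const_mul 4
  have i4 : Integrable (fun z : PhaseSpace N => A₈ * (z.1 ⟨0, h0N⟩) ^ 8) μ := ha8.const_mul A₈
  have i5 : Integrable (fun z : PhaseSpace N => 16 * β ^ 2 * (z.1 ⟨1, hN⟩) ^ 8) μ := hb8.const_mul _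
  have i12 : Integrable (fun z : PhaseSpace N => (z.2 ⟨0, h0N⟩) ^ 4 / 2 + A₄ * (z.1 ⟨0, h0N⟩) ^ 4) μ := i1.add i2
  have i123 : Integrable (fun z : PhaseSpace N => (z.2 ⟨0, h0N⟩) ^ 4 / 2 + A₄ * (z.1 ⟨0, h0N⟩) ^ 4 + 4 * (z.1 ⟨1, hN⟩) ^ 4) μ :=
    i12.add i3
  have i1234 : Integrable (fun z : PhaseSpace N => (z.2 ⟨0, h0N⟩) ^ 4 / 2 + A₄ * (z.1 ⟨0, h0N⟩) ^ 4 + 4 * (z.1 ⟨1, hN⟩) ^ 4 +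
      A₈ * (z.1 ⟨0, h0N⟩) ^ 8) μ := i123.add i4
  have hgi : Integrable g μ := i1234.add i5
  have hpt : ∀ z : PhaseSpace N, ((z.2 ⟨0, h0N⟩) ^ 2 / 2 + (pinnedChain ω₂ lam β γ).U (z.1 ⟨0, h0N⟩) +
      (pinnedChain ω₂ lam β γ).V (z.1 ⟨1, hN⟩ - z.1 ⟨0, h0N⟩) / 2) ^ 2 ≤ g z := fun z => by
    simp only [hg, hA₄, hA₈]
    exact siteEnergy_sq_le_pointwise ω₂ lam β γ _ _ _
  have hmono := integral_mono_of_nonneg (Eventually.of_forall fun z => sq_nonneg _) hgi (Eventually.of_forall hpt)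
  have hgval : ∫ z, g z ∂μ = (∫ z, (z.2 ⟨0, h0N⟩) ^ 4 ∂μ) / 2 + A₄ * ∫ z, (z.1 ⟨0, h0N⟩) ^ 4 ∂μ + 4 * ∫ z, (z.1 ⟨1, hN⟩) ^ 4 ∂μ +
      A₈ * ∫ z, (z.1 ⟨0, h0N⟩) ^ 8 ∂μ + 16 * β ^ 2 * ∫ z, (z.1 ⟨1, hN⟩) ^ 8 ∂μ := by
    show (∫ z, ((z.2 ⟨0, h0N⟩) ^ 4 / 2 + A₄ * (z.1 ⟨0, h0N⟩) ^ 4 + 4 * (z.1 ⟨1, hN⟩) ^ 4 + A₈ * (z.1 ⟨0, h0N⟩) ^ 8 +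
      16 * β ^ 2 * (z.1 ⟨1, hN⟩) ^ 8) ∂μ) = _
    rw [integral_add i1234 i5, integral_add i123 i4, integral_add i12 i3, integral_add i1 i2, integral_const_mul, integral_const_mul,
      integral_const_mul, integral_const_mul, integral_div]
  rw [hgval] at hmono
  have hT2 : 0 ≤ T ^ 2 := sq_nonneg T
  have hA₄0 : 0 ≤ A₄ := by positivity
  have hA₈0 : 0 ≤ A₈ := by positivity
  have e4 : (2 * T / ω₂) ^ 2 * R₄ = T ^ 2 * ((2 / ω₂) ^ 2 * R₄) := by ring
  have e8 : (4 * T / lam) ^ 2 * R₈ = T ^ 2 * ((4 / lam) ^ 2 * R₈) := by ring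
  rw [e4] at ha4le hb4le
  rw [e8] at ha8le hb8le
  have k1 : (∫ z, (z.2 ⟨0, h0N⟩) ^ 4 ∂μ) / 2 ≤ 3 / 2 * T ^ 2 := by linarith
  have k2 : A₄ * ∫ z, (z.1 ⟨0, h0N⟩) ^ 4 ∂μ ≤ A₄ * (T ^ 2 * ((2 / ω₂) ^ 2 * R₄)) := mul_le_mul_of_nonneg_left ha4le hA₄0
  have k3 : 4 * ∫ z, (z.1 ⟨1, hN⟩) ^ 4 ∂μ ≤ 4 * (T ^ 2 * ((2 / ω₂) ^ 2 * R₄)) := mul_le_mul_of_nonneg_left hb4le (by norm_num)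
  have k4 : A₈ * ∫ z, (z.1 ⟨0, h0N⟩) ^ 8 ∂μ ≤ A₈ * (T ^ 2 * ((4 / lam) ^ 2 * R₈)) := mul_le_mul_of_nonneg_left ha8le hA₈0
  have k5 : 16 * β ^ 2 * ∫ z, (z.1 ⟨1, hN⟩) ^ 8 ∂μ ≤ 16 * β ^ 2 * (T ^ 2 * ((4 / lam) ^ 2 * R₈)) :=
    mul_le_mul_of_nonneg_left hb8le (by positivity)
  have hfin : (∫ z, (z.2 ⟨0, h0N⟩) ^ 4 ∂μ) / 2 + A₄ * ∫ z, (z.1 ⟨0, h0N⟩) ^ 4 ∂μ + 4 * ∫ z, (z.1 ⟨1, hN⟩) ^ 4 ∂μ +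
      A₈ * ∫ z, (z.1 ⟨0, h0N⟩) ^ 8 ∂μ + 16 * β ^ 2 * ∫ z, (z.1 ⟨1, hN⟩) ^ 8 ∂μ ≤
      (3 / 2 + (2 * ω₂ ^ 2 + 8) * ((2 / ω₂) ^ 2 * R₄) + (lam ^ 2 / 2 + 32 * β ^ 2) * ((4 / lam) ^ 2 * R₈)) * T ^ 2 := by
    have : (3 / 2 + (2 * ω₂ ^ 2 + 8) * ((2 / ω₂) ^ 2 * R₄) + (lam ^ 2 / 2 + 32 * β ^ 2) * ((4 / lam) ^ 2 * R₈)) * T ^ 2 =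
        3 / 2 * T ^ 2 + A₄ * (T ^ 2 * ((2 / ω₂) ^ 2 * R₄)) + 4 * (T ^ 2 * ((2 / ω₂) ^ 2 * R₄)) +
        A₈ * (T ^ 2 * ((4 / lam) ^ 2 * R₈)) + 16 * β ^ 2 * (T ^ 2 * ((4 / lam) ^ 2 * R₈)) := by
      rw [hA₄, hA₈]; ring
    rw [this]; linarith
  exact hmono.trans hfin

end Summit.AtomisticToContinuum.FouriersLaw.Theorems.SubdiffusiveBondHeat

end
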